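import Summits.Ventures.QEC.Census.BB.BB288Data
import Summits.Ventures.QEC.Census.CertCheck
import Summits.Ventures.QEC.Theses.BB288DistanceCertificate
import HarnessLib

/-!
# Route BB288DistanceCertificate, item WeightEighteenZLogical (stmt-Ventures-19834): `BB.bb288`
# (`QC(x³+y²+y⁷, y³+x+x²)` on `ℤ₁₂ × ℤ₁₂`, the `[[288,12,18]]` CLAIM) has a `Z`-logical of weight exactly `18`

Upper witness: the weight-18 `Z`-type support `Z_witness_support` of `cert/search-2/bb288_witness.json` (qec-search-2,
kernel B; 18 qubits), as the word `witnessZ`; its NON-MEMBERSHIP witness `nonmemberZ` — a word `u` with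
`H^Z u = 0` and odd overlap with the witness, so the witness is not a product of `Z`-checks (type-02's
`not_mem_rowSpace_of_witness`) — was obtained by qec-type-10 by Gaussian elimination on `H^Z` (in-seat, 0.01 s) and is
DATA here: nothing about its provenance is trusted, the kernel re-checks both words against qec-type-02's row words
`Census.bb288HX` / `bb288HZ` (`Census/BB/BB288Data.lean`) through type-10's `upperOK` (`decide +kernel`: zero
`H^X`-syndrome, weight `18`, `u ∈ ker H^Z`, odd overlap). `upper_sound` gives the flat witness; type-02's index
identities `rowMatrix_bb288HX/HZ : rowMatrix 288 bb288H_ = BB.bb288.H_Flat` and type-05's `BB.Code.zWitness_of_flat`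
transport it to the typed code. Tier KERNEL, axioms standard. This certifies `d_Z(BB.bb288) ≤ 18`; the lower bound
(item NoZLogicalBelowEighteen) has no kernel path at `n = 288` tonight and stays COMPUTED evidence.
-/

namespace Summit.Ventures.QEC.Census.BB288

open Matrix Literature.InformationTheory.QuantumCodes

/-- The weight-18 `Z`-witness (qubits 2,5,9,10,36,38,44,46,72,73,75,77,78,79,80,82,108,112 of
cert/search-2/bb288_witness.json; bit `j` = qubit `j`). DATA. -/
def witnessZ : ℕ := 5516815419347639576949469376153124

/-- A non-membership witness for it: a word in `ker H^Z` with odd overlap with `witnessZ` (computed by row reduction;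
re-checked by the kernel below). DATA. -/
def nonmemberZ : ℕ := 2659106454823449097926516882662753280

/-- The `Z`-side upper check passes (kernel `decide`) on type-02's row words of `BB288`. -/
theorem upperZ_ok288 : upperOK 288 bb288HX bb288HZ 18 witnessZ nonmemberZ = true := by
  decide +kernel

/-- Commutation of the row words, inherited from the typed code through type-02's index identities. -/
theorem comm_flat288 : rowMatrix 288 bb288HX * (rowMatrix 288 bb288HZ)ᵀ = 0 := by
  rw [rowMatrix_bb288HX, rowMatrix_bb288HZ]
  exact BB.bb288.HXFlat_mul_HZFlat_transpose

/-- **Item WeightEighteenZLogical, PROVED**: some `Z`-type logical operator of `BB.bb288` has Hamming weight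
exactly `18` — checked in the kernel and transported to the typed code. -/
theorem weightEighteenZLogical_proof : Summit.Ventures.QEC.Theses.BB288DistanceCertificate.WeightEighteenZLogical := by
  obtain ⟨hv, hv', hwt⟩ := upper_sound upperZ_ok288
  exact BB.bb288.zWitness_of_flat (D := CSSCode.ofMatrices (rowMatrix 288 bb288HX) (rowMatrix 288 bb288HZ) comm_flat288)
    rowMatrix_bb288HX rowMatrix_bb288HZ ⟨ofBits 288 witnessZ, hv, hv', hwt⟩

end Summit.Ventures.QEC.Census.BB288
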